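import Literature.AlgebraicGeometry.Resolution.OneDimAnalyticallyUnramifiedReduced
import Literature.RingTheory.KrullDimension.AffineDimension
import Mathlib.RingTheory.Artinian.Ring
import Mathlib.RingTheory.DedekindDomain.PID
import Mathlib.RingTheory.DedekindDomain.Factorization
import Mathlib.RingTheory.IntegralClosure.IntegrallyClosed
import Mathlib.RingTheory.LocalProperties.Reduced
import Mathlib.RingTheory.KrullDimension.NonZeroDivisors
import HarnessLib

/-!
# The normalization of a reduced one-dimensional local ring is a principal ideal ring

Topic: `Literature/AlgebraicGeometry/Resolution`. Let `(R, 𝔪)` be a reduced Noetherian local ring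
of dimension one, `K` its total ring of fractions (`IsFractionRing R K`) and `R̄ ⊆ K` the integral
closure of `R` in `K`, assumed module-finite over `R` (e.g. `R̂` reduced: Kollár 2007,
Thm. 1.101). Classical structure behind the blow-up (`δ`-invariant) argument for REDUCED curve
germs (Kollár 2007, §1.13): `K = K₁ × ⋯ × K_r` is a finite product of fields (Stacks 02LX) and
`R̄ = R̄₁ × ⋯ × R̄_r` with `R̄_i` a semilocal Dedekind domain, hence a PID. PROVED over Mathlib:

* `isUnit_of_mem_nonZeroDivisors_of_isLocalization_fractionRing` — in any localization `L` of the
  total ring of fractions of a reduced Noetherian ring, non-zero-divisors are units (02LX);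
* `isFractionRing_of_isLocalization_of_forall_isUnit` — if `L` is a localization of `A` at
  non-zero-divisors and every non-zero-divisor of `L` is a unit, then `IsFractionRing A L`;
* `exists_mem_nonZeroDivisors_forall_mul_mem_range` — a conductor element `d ∈ R⁰`, `d R̄ ⊆ R`;
* `isPrincipalIdealRing_integralClosure` — **`R̄` is a principal ideal ring**: the images
  `R̄_I` of `R̄` in the residue fields `K/I` of the Artinian reduced ring `K` are integrally closed
  Noetherian domains of dimension `≤ 1` with fraction field `K/I` and finitely many maximal ideals
  (all lie over `𝔪`, which contains a non-zero-divisor), hence PIDs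
  (`IsPrincipalIdealRing.of_finite_maximals`); an ideal `J ⊆ R̄` is generated by `Σ_I e_I t_I`.

No definitions, no named facts.

Sources: J. Kollár, *Lectures on Resolution of Singularities* (2007), §1.13, Thm. 1.101
[Kollar2007]; The Stacks Project, Tags 00EW, 02LX [StacksProject].
-/

noncomputable section

open IsLocalRing Polynomial nonZeroDivisors

namespace Literature.AlgebraicGeometry.Resolution

universe u

/-! ## Non-zero-divisors of (localizations of) the total ring of fractions are units -/

section TotalFractions

/-- The total ring of fractions of a reduced ring is reduced (Stacks 02LX: it is even a product of
fields when the ring is Noetherian). [cite: StacksProject, Tag 02LX] -/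
theorem isReduced_of_isFractionRing (R : Type u) [CommRing R] [IsReduced R]
    (K : Type u) [CommRing K] [Algebra R K] [IsFractionRing R K] : IsReduced K := by
  haveI : IsReduced (Localization (R⁰)) := inferInstance
  exact isReduced_of_injective
    (IsLocalization.algEquiv R⁰ K (Localization R⁰)).toRingHom
    (IsLocalization.algEquiv R⁰ K (Localization R⁰)).injective

/-- In a localization `L` of the total ring of fractions `K` of a reduced Noetherian ring (in
particular in `K` itself), every non-zero-divisor is a unit: `K` is Artinian (Stacks 02LX) and
localizations of Artinian rings are Artinian. [cite: StacksProject, Tag 02LX] -/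
theorem isUnit_of_mem_nonZeroDivisors_of_isLocalization_fractionRing (R : Type u) [CommRing R]
    [IsReduced R] [IsNoetherianRing R] (K : Type u) [CommRing K] [Algebra R K]
    [IsFractionRing R K] (S : Submonoid K)
    (L : Type u) [CommRing L] [Algebra K L] [IsLocalization S L] {z : L} (hz : z ∈ L⁰) :
    IsUnit z := by
  haveI : IsArtinianRing K := isArtinianRing_of_isFractionRing_of_isReduced (R := R) K
  haveI : IsArtinianRing L := IsArtinianRing.localization_artinian S L
  exact IsArtinianRing.isUnit_of_mem_nonZeroDivisors hz

end TotalFractions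

/-! ## A criterion for being a total ring of fractions -/

section Criterion

variable {A : Type u} [CommRing A] (M : Submonoid A) (L : Type u) [CommRing L] [Algebra A L]
  [IsLocalization M L]

/-- If `L = M⁻¹A` with `M ⊆ A⁰` and every non-zero-divisor of `L` is a unit, then `L` is a total
ring of fractions of `A`: a non-zero-divisor of `A` stays a non-zero-divisor in `M⁻¹A`, hence
becomes a unit (used with Stacks 02LX: in the total ring of fractions of a reduced Noetherian ring
and its localizations, non-zero-divisors are units). [cite: StacksProject, Tag 02LX] -/
theorem isFractionRing_of_isLocalization_of_forall_isUnit (hM : M ≤ A⁰)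
    (hL : ∀ z ∈ L⁰, IsUnit z) : IsFractionRing A L := by
  refine IsLocalization.of_le M (A⁰) hM fun r hr => hL _ ?_
  -- `algebraMap A L r` is a non-zero-divisor
  rw [mem_nonZeroDivisors_iff_right]
  intro z hz
  obtain ⟨⟨a, m⟩, hz'⟩ := IsLocalization.surj M z
  -- `z * m = a`, and `a * r ↦ 0`, so `a * r` is killed by some element of `M`
  have h1 : algebraMap A L (a * r) = 0 := by
    rw [map_mul, ← hz', mul_assoc, mul_comm (algebraMap A L m), ← mul_assoc, hz, zero_mul]
  obtain ⟨m', hm'⟩ := (IsLocalization.map_eq_zero_iff M L _).mp h1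
  have h2 : (m' : A) * a = 0 := by
    have : ((m' : A) * a) * r = 0 := by rw [mul_assoc]; exact hm'
    exact (mem_nonZeroDivisors_iff_right.mp hr) _ this
  have h3 : algebraMap A L ((m' : A) * a) = 0 := by rw [h2, map_zero]
  rw [map_mul] at h3
  have h4 : algebraMap A L a = 0 :=
    (IsLocalization.map_units L m').mul_right_eq_zero.mp h3
  have h5 : z * algebraMap A L m = 0 := by rw [hz', h4]
  exact (IsLocalization.map_units L m).mul_left_eq_zero.mp h5

end Criterion

/-! ## The conductor: a common denominator of the normalization -/

section Conductor

variable (R : Type u) [CommRing R] (K : Type u) [CommRing K] [Algebra R K] [IsFractionRing R K]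

/-- If the integral closure `R̄` of `R` in its total ring of fractions is module-finite, there is
a non-zero-divisor `d ∈ R` with `d · R̄ ⊆ R` (a common denominator of finitely many
generators; the conductor of `R̄/R` contains a non-zero-divisor — the finiteness input of Kollár's
Thm. 1.101 (2)). [cite: Kollar2007, Thm. 1.101] -/
theorem exists_mem_nonZeroDivisors_forall_mul_mem_range
    [Module.Finite R (integralClosure R K)] :
    ∃ d ∈ R⁰, ∀ z ∈ integralClosure R K, algebraMap R K d * z ∈ (algebraMap R K).range := by
  classical
  set W := integralClosure R K with hW
  obtain ⟨T, hT⟩ := Module.Finite.fg_top (R := R) (M := W)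
  have hgen : ∀ w : W, ∃ a : R, ∃ b ∈ R⁰, (w : K) * algebraMap R K b = algebraMap R K a := by
    intro w
    obtain ⟨⟨a, b⟩, h⟩ := IsLocalization.surj R⁰ (w : K)
    exact ⟨a, b, b.2, h⟩
  choose fa fb hfb hfab using hgen
  set d : R := ∏ w ∈ T, fb w with hd
  have hd0 : d ∈ R⁰ := by
    rw [hd]
    exact Finset.prod_induction _ (· ∈ R⁰) (fun _ _ ha hb => mul_mem ha hb) (one_mem _)
      fun w _ => hfb w
  have hdT : ∀ w ∈ T, ∃ a : R, algebraMap R K d * (w : K) = algebraMap R K a := by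
    intro w hw
    obtain ⟨d', hd'⟩ : fb w ∣ d := Finset.dvd_prod_of_mem _ hw
    refine ⟨fa w * d', ?_⟩
    rw [hd', map_mul, mul_comm, ← mul_assoc, hfab w, map_mul]
  refine ⟨d, hd0, fun z hz => ?_⟩
  have hz' : (⟨z, hz⟩ : W) ∈ Submodule.span R (T : Set W) := by rw [hT]; trivial
  -- induction over the span
  suffices h : ∀ w : W, w ∈ Submodule.span R (T : Set W) →
      algebraMap R K d * (w : K) ∈ (algebraMap R K).range from h ⟨z, hz⟩ hz'
  intro w hw
  induction hw using Submodule.span_induction with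
  | mem w hw =>
    obtain ⟨a, ha⟩ := hdT w hw
    exact ⟨a, ha.symm⟩
  | zero => exact ⟨0, by simp⟩
  | add w₁ w₂ _ _ h₁ h₂ =>
    obtain ⟨a₁, h₁⟩ := h₁
    obtain ⟨a₂, h₂⟩ := h₂
    refine ⟨a₁ + a₂, ?_⟩
    rw [map_add, h₁, h₂, Subalgebra.coe_add, mul_add]
  | smul r w _ hw =>
    obtain ⟨a, ha⟩ := hw
    refine ⟨r * a, ?_⟩
    rw [map_mul, ha, Subalgebra.coe_smul, Algebra.smul_def, mul_left_comm]

end Conductor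

/-! ## The normalization of a reduced one-dimensional local ring is a principal ideal ring -/

section Principal

variable (R : Type u) [CommRing R] [IsLocalRing R] [IsNoetherianRing R] [IsReduced R]
  (K : Type u) [CommRing K] [Algebra R K] [IsFractionRing R K]

/-- An idempotent-type lift: for a maximal ideal `I` of the (Artinian, reduced) total ring of
fractions `K`, there is `e ∈ R̄` mapping to `1` in `K/I` and to `0` in every other `K/J`.
[cite: StacksProject, Tag 02LX] -/
theorem exists_idempotent_lift (I : MaximalSpectrum K) :
    ∃ e ∈ integralClosure R K, Ideal.Quotient.mk I.asIdeal e = 1 ∧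
      ∀ J : MaximalSpectrum K, J ≠ I → Ideal.Quotient.mk J.asIdeal e = 0 := by
  classical
  haveI : IsArtinianRing K := isArtinianRing_of_isFractionRing_of_isReduced (R := R) K
  haveI : IsReduced K := isReduced_of_isFractionRing R K
  set E := IsArtinianRing.equivPi K with hE
  set f : ∀ J : MaximalSpectrum K, K ⧸ J.asIdeal := Pi.single I 1 with hf
  set e : K := E.symm f with he
  have hproj : ∀ J : MaximalSpectrum K, Ideal.Quotient.mk J.asIdeal e = f J := by
    intro J
    have h1 : E e J = f J := by
      rw [he, AlgEquiv.apply_symm_apply]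
    rw [IsArtinianRing.equivPi_apply] at h1
    exact h1
  refine ⟨e, ?_, ?_, ?_⟩
  · -- `e² = e`, so `e` is a root of `X² - X`
    have hff : f * f = f := by
      rw [hf, ← Pi.single_mul, mul_one]
    have hee : e * e = e := by
      rw [he, ← map_mul, hff]
    refine ⟨X ^ 2 - X, (monic_X_pow 2).sub_of_left (by rw [degree_X_pow, degree_X]; decide), ?_⟩
    rw [eval₂_sub, eval₂_X_pow, eval₂_X, pow_two, hee, sub_self]
  · rw [hproj, hf, Pi.single_eq_same]
  · intro J hJ
    rw [hproj, hf, Pi.single_eq_of_ne hJ]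

/-- Elements of `K` agreeing in every residue field `K/I`, `I` maximal, are equal (`K` is a
reduced Artinian ring, `K ≅ ∏ K/I`). [cite: StacksProject, Tag 02LX] -/
theorem eq_of_forall_quotient_mk_eq {K : Type u} [CommRing K] [IsArtinianRing K] [IsReduced K]
    {x y : K}
    (h : ∀ I : MaximalSpectrum K, Ideal.Quotient.mk I.asIdeal x = Ideal.Quotient.mk I.asIdeal y) :
    x = y := by
  apply (IsArtinianRing.equivPi K).injective
  funext I
  rw [IsArtinianRing.equivPi_apply, IsArtinianRing.equivPi_apply]
  exact h I


/-- The image `R̄_I ⊆ K/I` of the integral closure `R̄` in a residue field of the total ring of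
fractions is a principal ideal domain: an integrally closed Noetherian domain of dimension `≤ 1`
with fraction field `K/I` (a Dedekind domain) having finitely many maximal ideals — each contains
the image of a non-zero-divisor `c ∈ 𝔪`, which is nonzero in `K/I`.
[cite: Kollar2007, Thm. 1.101] -/
theorem isPrincipalIdealRing_map_integralClosure (hdim : ringKrullDim R = 1)
    [Module.Finite R (integralClosure R K)] (I : MaximalSpectrum K) :
    IsPrincipalIdealRing ↥((integralClosure R K).map (Ideal.Quotient.mkₐ R I.asIdeal)) := by
  classical
  haveI : IsArtinianRing K := isArtinianRing_of_isFractionRing_of_isReduced (R := R) K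
  haveI : IsReduced K := isReduced_of_isFractionRing R K
  letI hKI : Field (K ⧸ I.asIdeal) := Ideal.Quotient.field I.asIdeal
  set π : K →ₐ[R] K ⧸ I.asIdeal := Ideal.Quotient.mkₐ R I.asIdeal with hπdef
  have hπ : ∀ x : K, π x = Ideal.Quotient.mk I.asIdeal x := fun x => rfl
  set N := integralClosure R K with hN
  set NI : Subalgebra R (K ⧸ I.asIdeal) := N.map π with hNI
  -- the structure maps
  have hval : ∀ y : NI, algebraMap NI (K ⧸ I.asIdeal) y = (y : K ⧸ I.asIdeal) := fun y => rfl
  have hvalR : ∀ r : R, ((algebraMap R NI r : NI) : K ⧸ I.asIdeal) =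
      π (algebraMap R K r) := fun r => by
    rw [AlgHom.commutes]; rfl
  -- (1) `NI` is integral and module-finite over `R`, hence a Noetherian domain
  haveI hint : Algebra.IsIntegral R NI := by
    refine ⟨fun x => ?_⟩
    obtain ⟨y, hy, hyx⟩ := Subalgebra.mem_map.mp x.2
    have h1 : IsIntegral R (π y) := IsIntegral.map π hy
    rw [hyx] at h1
    exact (isIntegral_algHom_iff NI.val Subtype.val_injective).mp h1
  haveI hfinNI : Module.Finite R NI :=
    Module.Finite.of_surjective (π.subalgebraMap N).toLinearMap (AlgHom.subalgebraMap_surjective N π)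
  haveI : IsNoetherianRing NI :=
    isNoetherian_of_tower R (isNoetherian_of_isNoetherianRing_of_finite R NI)
  -- a non-zero-divisor `c ∈ 𝔪`; its image in `NI` is nonzero
  obtain ⟨c, hcm, hc0⟩ := exists_mem_maximalIdeal_mem_nonZeroDivisors R hdim
  have hunit : ∀ s : R, s ∈ R⁰ → IsUnit (π (algebraMap R K s)) := fun s hs =>
    (IsLocalization.map_units K ⟨s, hs⟩).map π
  have hne : ∀ s : R, s ∈ R⁰ → (algebraMap R NI s : NI) ≠ 0 := by
    intro s hs h
    have h' : ((algebraMap R NI s : NI) : K ⧸ I.asIdeal) = 0 := by rw [h]; rfl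
    rw [hvalR] at h'
    exact (hunit s hs).ne_zero h'
  -- (2) `K/I` is the fraction field of `NI`
  haveI hfrac : IsFractionRing NI (K ⧸ I.asIdeal) := by
    refine (isLocalization_iff _ _).mpr ⟨?_, ?_, ?_⟩
    · rintro ⟨y, hy⟩
      exact isUnit_iff_ne_zero.mpr (by
        rw [hval]; exact Subtype.coe_ne_coe.mpr (nonZeroDivisors.ne_zero hy))
    · intro z
      obtain ⟨q, rfl⟩ := Ideal.Quotient.mk_surjective z
      obtain ⟨⟨a, s⟩, hq⟩ := IsLocalization.surj R⁰ q
      refine ⟨⟨algebraMap R NI a, ⟨algebraMap R NI s, mem_nonZeroDivisors_of_ne_zero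
        (hne s s.2)⟩⟩, ?_⟩
      change Ideal.Quotient.mk I.asIdeal q * ((algebraMap R NI (s : R) : NI) : K ⧸ I.asIdeal) =
        ((algebraMap R NI a : NI) : K ⧸ I.asIdeal)
      rw [hvalR, hvalR, hπ, hπ, ← map_mul, hq]
    · intro x y hxy
      exact ⟨1, by rw [Subtype.ext hxy]⟩
  -- (3) `NI` is integrally closed
  haveI hic : IsIntegrallyClosed NI := by
    refine (isIntegrallyClosed_iff (K ⧸ I.asIdeal)).mpr fun {x} hx => ?_
    have hxR : IsIntegral R x := isIntegral_trans x hx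
    obtain ⟨p, hp, hpx⟩ := hxR
    obtain ⟨q₀, hq₀⟩ := Ideal.Quotient.mk_surjective x
    obtain ⟨e, heN, heI, heJ⟩ := exists_idempotent_lift R K I
    -- `q = e q₀` is a root of `X · p`
    have hq : IsIntegral R (e * q₀) := by
      refine ⟨X * p, monic_X.mul hp, ?_⟩
      apply eq_of_forall_quotient_mk_eq (K := K)
      intro J
      rw [map_zero, Polynomial.hom_eval₂, eval₂_mul, eval₂_X, map_mul]
      by_cases hJ : J = I
      · subst hJ
        rw [heI, one_mul, hq₀]
        have : eval₂ ((Ideal.Quotient.mk J.asIdeal).comp (algebraMap R K)) x p = 0 := hpx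
        rw [this, mul_zero]
      · rw [heJ J hJ, zero_mul, zero_mul]
    refine ⟨⟨π (e * q₀), Subalgebra.mem_map.mpr ⟨e * q₀, hq, rfl⟩⟩, ?_⟩
    rw [hval]
    change π (e * q₀) = x
    rw [map_mul, hπ e, heI, one_mul, hπ, hq₀]
  -- (4) dimension `≤ 1`, so `NI` is a Dedekind domain
  have hdimNI : ringKrullDim NI ≤ 1 :=
    (Literature.RingTheory.KrullDimension.ringKrullDim_le_of_isIntegral (R := R) (S := NI)).trans
      hdim.le
  haveI : Ring.KrullDimLE 1 NI := Ring.krullDimLE_iff.mpr hdimNI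
  haveI : Ring.DimensionLEOne NI :=
    ⟨fun hne hp => (Ring.krullDimLE_one_iff_of_noZeroDivisors.mp inferInstance) _ hne hp⟩
  haveI : IsDedekindDomain NI := { }
  -- (5) finitely many maximal ideals: all contain the nonzero element `c`
  set cN : NI := algebraMap R NI c with hcN
  have hJ0 : Ideal.span {cN} ≠ ⊥ := by
    rw [Ne, Ideal.span_singleton_eq_bot]; exact hne c hc0
  have hmax : ∀ P : Ideal NI, P.IsMaximal → Ideal.span {cN} ≤ P := by
    intro P hP
    rw [Ideal.span_singleton_le_iff_mem]
    have h1 : (P.comap (algebraMap R NI)).IsMaximal :=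
      Ideal.isMaximal_comap_of_isIntegral_of_isMaximal (R := R) P
    have h2 : P.comap (algebraMap R NI) = maximalIdeal R := IsLocalRing.eq_maximalIdeal h1
    have h3 : c ∈ P.comap (algebraMap R NI) := h2 ▸ hcm
    exact h3
  have hfin : {P : Ideal NI | P.IsMaximal}.Finite := by
    refine ((Ideal.finite_factors hJ0).image
      (fun v : IsDedekindDomain.HeightOneSpectrum NI => v.asIdeal)).subset ?_
    intro P hP
    have hPmax : P.IsMaximal := hP
    have hPne : P ≠ ⊥ := fun h => hJ0 (le_bot_iff.mp (h ▸ hmax P hPmax))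
    refine ⟨⟨P, hPmax.isPrime, hPne⟩, ?_, rfl⟩
    change P ∣ Ideal.span {cN}
    exact Ideal.dvd_iff_le.mpr (hmax P hPmax)
  exact IsPrincipalIdealRing.of_finite_maximals hfin

/-- **The normalization of a reduced one-dimensional local ring is a principal ideal ring** (it is
a finite product of semilocal Dedekind domains): every ideal `J` of the module-finite integral
closure `R̄ ⊆ K` is principal, generated by `Σ_I e_I t_I` where, for each maximal ideal `I` of the
Artinian reduced ring `K`, `e_I ∈ R̄` is the corresponding idempotent and `t_I ∈ J` maps to a
generator of the image of `J` in the PID `R̄_I ⊆ K/I`. In particular `𝔪 R̄` is principal.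
[cite: Kollar2007, Thm. 1.101] -/
theorem isPrincipalIdealRing_integralClosure (hdim : ringKrullDim R = 1)
    [Module.Finite R (integralClosure R K)] :
    IsPrincipalIdealRing (integralClosure R K) := by
  classical
  haveI : IsArtinianRing K := isArtinianRing_of_isFractionRing_of_isReduced (R := R) K
  haveI : IsReduced K := isReduced_of_isFractionRing R K
  haveI : Fintype (MaximalSpectrum K) := Fintype.ofFinite _
  set N := integralClosure R K with hN
  -- notation for the components
  let F : MaximalSpectrum K → Type u := fun I => K ⧸ I.asIdeal
  let π : ∀ I : MaximalSpectrum K, K →ₐ[R] F I := fun I => Ideal.Quotient.mkₐ R I.asIdeal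
  have hπ : ∀ (I) (x : K), π I x = Ideal.Quotient.mk I.asIdeal x := fun I x => rfl
  let π' : ∀ I : MaximalSpectrum K, N →ₐ[R] (N.map (π I)) := fun I => (π I).subalgebraMap N
  have hπ' : ∀ (I) (x : N), ((π' I x : N.map (π I)) : F I) = π I (x : K) := fun I x => rfl
  have hπ'surj : ∀ I, Function.Surjective (π' I) := fun I => AlgHom.subalgebraMap_surjective N (π I)
  haveI hPI : ∀ I : MaximalSpectrum K, IsPrincipalIdealRing (N.map (π I)) := fun I =>
    isPrincipalIdealRing_map_integralClosure R K hdim I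
  -- idempotents
  have hid := fun I : MaximalSpectrum K => exists_idempotent_lift R K I
  choose e heN heI heJ using hid
  refine ⟨fun J => ?_⟩
  -- generators of the images
  have hgen : ∀ I : MaximalSpectrum K, ∃ t : N, t ∈ J ∧ J.map (π' I) = Ideal.span {π' I t} := by
    intro I
    obtain ⟨τ, hτ⟩ := (hPI I).principal (J.map (π' I))
    have hτmem : τ ∈ J.map (π' I) := by rw [hτ]; exact Ideal.mem_span_singleton_self τ
    obtain ⟨t, htJ, htτ⟩ := (Ideal.mem_map_iff_of_surjective (π' I) (hπ'surj I)).mp hτmem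
    exact ⟨t, htJ, by rw [htτ]; exact hτ⟩
  choose t htJ htgen using hgen
  set τ : N := ∑ I, (⟨e I, heN I⟩ : N) * t I with hτdef
  have hτJ : τ ∈ J := Ideal.sum_mem _ fun I _ => Ideal.mul_mem_left _ _ (htJ I)
  -- components of sums against the idempotents
  have hcomp : ∀ (m : MaximalSpectrum K → N) (I₀ : MaximalSpectrum K),
      π I₀ ((∑ I, (⟨e I, heN I⟩ : N) * m I : N) : K) = π I₀ (m I₀ : K) := by
    intro m I₀
    rw [AddSubmonoidClass.coe_finsetSum, map_sum]
    rw [Finset.sum_eq_single I₀]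
    · rw [Subalgebra.coe_mul, map_mul]
      change π I₀ (e I₀) * _ = _
      rw [hπ, heI, one_mul]
    · intro I _ hI
      rw [Subalgebra.coe_mul, map_mul]
      change π I₀ (e I) * _ = 0
      rw [hπ, heJ I I₀ (Ne.symm hI), zero_mul]
    · intro h; exact absurd (Finset.mem_univ I₀) h
  refine ⟨⟨τ, le_antisymm ?_ ?_⟩⟩
  · -- `J ≤ (τ)`
    intro x hx
    have hxI : ∀ I, ∃ m : N, π' I x = π' I m * π' I (t I) := by
      intro I
      have h1 : π' I x ∈ J.map (π' I) := Ideal.mem_map_of_mem _ hx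
      rw [htgen I] at h1
      obtain ⟨a, ha⟩ := Ideal.mem_span_singleton'.mp h1
      obtain ⟨m, hm⟩ := hπ'surj I a
      exact ⟨m, by rw [hm, ha]⟩
    choose m hm using hxI
    set n : N := ∑ I, (⟨e I, heN I⟩ : N) * m I with hndef
    have hxn : x = n * τ := by
      apply Subtype.ext
      apply eq_of_forall_quotient_mk_eq (K := K)
      intro I₀
      rw [← hπ, ← hπ, Subalgebra.coe_mul, map_mul]
      rw [hndef, hτdef, hcomp m I₀, hcomp t I₀, ← hπ', ← hπ', ← hπ', hm I₀]
      rfl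
    rw [hxn]
    exact Ideal.mul_mem_left _ _ (Ideal.mem_span_singleton_self τ)
  · rw [Ideal.span_singleton_le_iff_mem]
    exact hτJ

end Principal

end Literature.AlgebraicGeometry.Resolution

end
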